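import Mathlib
import Summits.Ventures.PercRepro2.CoinChainXAJpGateFacts

/-!
# Gate facts for family B of the (j, j′) markers: the comparable-pair bounds on the `m`-fibre
(blind cell PercRepro2, night-2 g29; proofs/NIGHT2-DARC.md §71)

Set-level Ahlswede–Daykin instances of the cross-log-supermodularity `(d, d')` on the fibres of `E = {m, j, j'}`:
the monotonicity of the relative openness along `m ⊆ mj`, `m ⊆ mj'` (`u_mj·w_m ≤ u_m·w_mj`, `u_mj'·w_m ≤ u_m·w_mj'`) and
the bound of the `m`-fibre by the top fibre (`u_mjj'·w_m ≤ u_m·w_mjj'`) — the three facts the family-B corner argument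
(`xa_jp_core_B`) adds to those of family A (`CoinChainXAJpGateFacts`).
-/

namespace Summit.Ventures.PercRepro2.Coin

open Classical

section JpGateFactsB

variable {V : Type*} [DecidableEq V] {R : Type*} [Field R] [LinearOrder R] [IsStrictOrderedRing R]

/-- Monotonicity of the gate's relative openness along `m ⊆ mj`: `u_mj·w_m ≤ u_m·w_mj`. -/
lemma jp_mono_m_mj (U : Finset V) (m j j' : V)
    (ν d d' : Finset V → R)
    (hν0 : ∀ W, 0 ≤ ν W) (hν : ∀ s ⊆ U, ∀ t ⊆ U, ν s * ν t ≤ ν (s ∩ t) * ν (s ∪ t))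
    (hd0 : ∀ W, 0 ≤ d W) (hd'0 : ∀ W, 0 ≤ d' W)
    (hdd' : ∀ s t, d s * d' t ≤ d (s ∩ t) * d' (s ∪ t)) :
    (∑ W ∈ U.powerset.filter (fun W => m ∈ W ∧ j ∈ W ∧ j' ∉ W), ν W * d W) * (∑ W ∈ U.powerset.filter (fun W => m ∈ W ∧ j ∉ W ∧ j' ∉ W), ν W * d' W) ≤ (∑ W ∈ U.powerset.filter (fun W => m ∈ W ∧ j ∉ W ∧ j' ∉ W), ν W * d W) * (∑ W ∈ U.powerset.filter (fun W => m ∈ W ∧ j ∈ W ∧ j' ∉ W), ν W * d' W) := by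
  have h := ad_sets_dec U (fun W => ν W * d W) (fun W => ν W * d' W) (fun W => ν W * d W) (fun W => ν W * d' W)
    (fun W => mul_nonneg (hν0 W) (hd0 W)) (fun W => mul_nonneg (hν0 W) (hd'0 W)) (fun W => mul_nonneg (hν0 W) (hd0 W)) (fun W => mul_nonneg (hν0 W) (hd'0 W))
    (fun W => (m ∈ W ∧ j ∈ W ∧ j' ∉ W)) (fun W => (m ∈ W ∧ j ∉ W ∧ j' ∉ W)) (fun W => (m ∈ W ∧ j ∉ W ∧ j' ∉ W)) (fun W => (m ∈ W ∧ j ∈ W ∧ j' ∉ W))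
    (fun s hs t ht hA hB => by
      exact ⟨⟨(Finset.mem_inter.2 ⟨hA.1, hB.1⟩), (fun hh => hB.2.1 (Finset.mem_inter.1 hh).2), (fun hh => hA.2.2 (Finset.mem_inter.1 hh).1)⟩, ⟨(Finset.mem_union_left _ hA.1), (Finset.mem_union_left _ hA.2.1), (fun hh => (Finset.mem_union.1 hh).elim hA.2.2 hB.2.2)⟩, six_pw_dw U ν d d' hν0 hν hd0 hd'0 hdd' s hs t ht⟩)
  exact h

/-- Monotonicity of the gate's relative openness along `m ⊆ mj'`: `u_mj'·w_m ≤ u_m·w_mj'`. -/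
lemma jp_mono_m_mjp (U : Finset V) (m j j' : V)
    (ν d d' : Finset V → R)
    (hν0 : ∀ W, 0 ≤ ν W) (hν : ∀ s ⊆ U, ∀ t ⊆ U, ν s * ν t ≤ ν (s ∩ t) * ν (s ∪ t))
    (hd0 : ∀ W, 0 ≤ d W) (hd'0 : ∀ W, 0 ≤ d' W)
    (hdd' : ∀ s t, d s * d' t ≤ d (s ∩ t) * d' (s ∪ t)) :
    (∑ W ∈ U.powerset.filter (fun W => m ∈ W ∧ j ∉ W ∧ j' ∈ W), ν W * d W) * (∑ W ∈ U.powerset.filter (fun W => m ∈ W ∧ j ∉ W ∧ j' ∉ W), ν W * d' W) ≤ (∑ W ∈ U.powerset.filter (fun W => m ∈ W ∧ j ∉ W ∧ j' ∉ W), ν W * d W) * (∑ W ∈ U.powerset.filter (fun W => m ∈ W ∧ j ∉ W ∧ j' ∈ W), ν W * d' W) := by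
  have h := ad_sets_dec U (fun W => ν W * d W) (fun W => ν W * d' W) (fun W => ν W * d W) (fun W => ν W * d' W)
    (fun W => mul_nonneg (hν0 W) (hd0 W)) (fun W => mul_nonneg (hν0 W) (hd'0 W)) (fun W => mul_nonneg (hν0 W) (hd0 W)) (fun W => mul_nonneg (hν0 W) (hd'0 W))
    (fun W => (m ∈ W ∧ j ∉ W ∧ j' ∈ W)) (fun W => (m ∈ W ∧ j ∉ W ∧ j' ∉ W)) (fun W => (m ∈ W ∧ j ∉ W ∧ j' ∉ W)) (fun W => (m ∈ W ∧ j ∉ W ∧ j' ∈ W))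
    (fun s hs t ht hA hB => by
      exact ⟨⟨(Finset.mem_inter.2 ⟨hA.1, hB.1⟩), (fun hh => hA.2.1 (Finset.mem_inter.1 hh).1), (fun hh => hB.2.2 (Finset.mem_inter.1 hh).2)⟩, ⟨(Finset.mem_union_left _ hA.1), (fun hh => (Finset.mem_union.1 hh).elim hA.2.1 hB.2.1), (Finset.mem_union_left _ hA.2.2)⟩, six_pw_dw U ν d d' hν0 hν hd0 hd'0 hdd' s hs t ht⟩)
  exact h

/-- The bound of the `m`-fibre by the top fibre: `u_mjj'·w_m ≤ u_m·w_mjj'`. -/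
lemma jp_top_m (U : Finset V) (m j j' : V)
    (ν d d' : Finset V → R)
    (hν0 : ∀ W, 0 ≤ ν W) (hν : ∀ s ⊆ U, ∀ t ⊆ U, ν s * ν t ≤ ν (s ∩ t) * ν (s ∪ t))
    (hd0 : ∀ W, 0 ≤ d W) (hd'0 : ∀ W, 0 ≤ d' W)
    (hdd' : ∀ s t, d s * d' t ≤ d (s ∩ t) * d' (s ∪ t)) :
    (∑ W ∈ U.powerset.filter (fun W => m ∈ W ∧ j ∈ W ∧ j' ∈ W), ν W * d W) * (∑ W ∈ U.powerset.filter (fun W => m ∈ W ∧ j ∉ W ∧ j' ∉ W), ν W * d' W) ≤ (∑ W ∈ U.powerset.filter (fun W => m ∈ W ∧ j ∉ W ∧ j' ∉ W), ν W * d W) * (∑ W ∈ U.powerset.filter (fun W => m ∈ W ∧ j ∈ W ∧ j' ∈ W), ν W * d' W) := by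
  have h := ad_sets_dec U (fun W => ν W * d W) (fun W => ν W * d' W) (fun W => ν W * d W) (fun W => ν W * d' W)
    (fun W => mul_nonneg (hν0 W) (hd0 W)) (fun W => mul_nonneg (hν0 W) (hd'0 W)) (fun W => mul_nonneg (hν0 W) (hd0 W)) (fun W => mul_nonneg (hν0 W) (hd'0 W))
    (fun W => (m ∈ W ∧ j ∈ W ∧ j' ∈ W)) (fun W => (m ∈ W ∧ j ∉ W ∧ j' ∉ W)) (fun W => (m ∈ W ∧ j ∉ W ∧ j' ∉ W)) (fun W => (m ∈ W ∧ j ∈ W ∧ j' ∈ W))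
    (fun s hs t ht hA hB => by
      exact ⟨⟨(Finset.mem_inter.2 ⟨hA.1, hB.1⟩), (fun hh => hB.2.1 (Finset.mem_inter.1 hh).2), (fun hh => hB.2.2 (Finset.mem_inter.1 hh).2)⟩, ⟨(Finset.mem_union_left _ hA.1), (Finset.mem_union_left _ hA.2.1), (Finset.mem_union_left _ hA.2.2)⟩, six_pw_dw U ν d d' hν0 hν hd0 hd'0 hdd' s hs t ht⟩)
  exact h

end JpGateFactsB

end Summit.Ventures.PercRepro2.Coin
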